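import Summits.BirchSwinnertonDyer.BirchSwinnertonDyer.Theses.AdditiveBranchIMC
import HarnessLib

/-!
# K1 route `AdditiveBranchIMC` — `ReadingFacts` child RF-4 `GreenbergVatsalLiftingEven`
# (item stmt-BirchSwinnertonDyer-19299) BY NAME: the reading reduced to Greenberg–Vatsal's PRINTED
# display `H¹(ℚ_Σ/ℚ_∞, E[p]) →ε H¹(ℚ_Σ/ℚ_∞, Ψ) → 0` (p. 28), in the tree's vocabulary

Cell `bsd-addord` (home `run/shared/lean/pub/bsd-addord/`), inputs seat `bsd-inputs-abimc-rf-p2`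
(director-bsd g13 (172)(f′); pen = planner g28, REQUESTS l.30191 (C)). HONEST FRAMING: nothing here
proves the Birch–Swinnerton-Dyer conjecture, the crux `ReadingFacts` (19361) or the reading fact; BSD
is not proved by any of this. THEOREMS ONLY: no `def`, no named fact, no `sorry`; the printed display
enters as an EXPLICIT HYPOTHESIS spelled out inline (it is not filed as a Literature constant — it
would be a strengthening of this seat's own item, CONVENTIONS §4 / prover rule (e)).

## What the item says and what is printed

RF-4 `GreenbergVatsalLiftingEven :=
Literature.NumberTheory.EllipticCurves.GreenbergVatsal2000.residualEpsilon_surjOn_of_lineEven`: for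
`E/ℚ` on a globally minimal model, `p ≠ 2`, `κ` the cyclotomic `ℤ_p`-extension, `Φ₀ ≤ E[p]` a
rational EVEN line, `S₀ ∌ p` finite containing the bad places `≠ p`, every class of
`residualQuotSelmer` (`= U ∩ H¹(ℚ_Σ/ℚ_∞, Ψ)`, GV p. 28 "`U = ker(H¹(ℚ_Σ/ℚ_∞, Ψ) → H¹(I_p, Ψ))`")
is `ε x` for some `x ∈ residualTorsionH1` (`= H¹(ℚ_Σ/ℚ_∞, E[p])`). What Greenberg–Vatsal PRINT
(p. 28, justified on p. 30 by `H²(ℚ_Σ/ℚ_∞, Φ) = 0` "because `φ` is even") is the exact sequence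
`0 → H¹(ℚ_Σ/ℚ_∞, Φ) → H¹(ℚ_Σ/ℚ_∞, E[p]) →ε H¹(ℚ_Σ/ℚ_∞, Ψ) → 0`, i.e. that `ε` is ONTO
`H¹(ℚ_Σ/ℚ_∞, Ψ)` — in the tree's place-by-place model (`GreenbergVatsal2000/ResidualSelmerGroups.lean`,
`GreenbergSelmerGroups.lean`) the group `H¹(ℚ_Σ/ℚ_∞, Ψ)` is
`unramifiedOutside κ.kerSubgroup (residualLine Φ₀ hΦ).Quot p ↑S₀` (same constructor as
`residualLineH1 = H¹(ℚ_Σ/ℚ_∞, Φ)` and `residualTorsionH1 = H¹(ℚ_Σ/ℚ_∞, E[p])`), and `U`'s part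
`residualQuotSelmer = unramifiedSelmer …` is by DEFINITION its subgroup cut out by the unramified
condition above `p` (`unramifiedSelmer = unramifiedOutside ⊓ ⨅_{v ∣ p} …`).

## What is here (all proved)

* §1 `residualQuotSelmer_le_unramifiedOutside` — `U ∩ H¹(ℚ_Σ/ℚ_∞, Ψ) ≤ H¹(ℚ_Σ/ℚ_∞, Ψ)` in the model.
* §2 `lift_of_display` — for ONE datum `(W, p, κ, S₀, Φ₀)`: the printed right-exactness of the display
  (every class of `H¹(ℚ_Σ/ℚ_∞, Ψ)` is `ε x`, `x ∈ H¹(ℚ_Σ/ℚ_∞, E[p])`) gives the item's lifting on `U`.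
* §3 `greenbergVatsalLiftingEven_of_display`, `greenbergVatsalLiftingRamifiedEven_of_display` — the
  route declarations RF-4 (19299) and RF-3 (19298) from the display quantified over the items' data
  (even line, resp. with the ramified hypothesis idle), and `readingFacts_of_display` — the crux
  `ReadingFacts` from RF-1, RF-2, RF-5 and the display. So the READING content of 19298/19299 beyond
  the printed display is NIL in the tree's model: the two items are exactly "the p. 28 display for an
  even rational line of an elliptic curve over `ℚ_∞`" read on `U`.

Size verdict for discharging the display itself (first-hand, 2026-08-28): XL — `subgroupH1` is
Mathlib's `continuousCohomology 1`; neither `H²`, nor the long exact cohomology sequence of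
`0 → Φ → E[p] → Ψ → 0`, nor `Gal(ℚ_Σ/ℚ_∞)`-cohomology with inflation–restriction exist in Mathlib or
the tree, and the printed input `H²(ℚ_Σ/ℚ_∞, Φ) = 0` rests on Iwasawa's theorem for the even character
`φ`, Ferrero–Washington, GV Prop. (2.5) and Greenberg 1989 Prop. 4 (p. 30), none typed.

References: [GreenbergVatsal2000] R. Greenberg, V. Vatsal, *On the Iwasawa invariants of elliptic
curves*, Invent. Math. 142 (2000) 17–63, §2 p. 28 (the display and `U`), p. 29 (`S_Ψ(ℚ_∞) = H¹_unr`),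
p. 30 (`H²(ℚ_Σ/ℚ_∞, Φ) = 0`).
-/

set_option autoImplicit false
-- the problem directory `BirchSwinnertonDyer/BirchSwinnertonDyer` forces a duplicated namespace component
set_option linter.dupNamespace false

noncomputable section

open scoped Classical

namespace Summit.BirchSwinnertonDyer.BirchSwinnertonDyer.Theorems.AdditiveBranchIMCGreenbergVatsalLiftingEven

open NumberField IsDedekindDomain Field WeierstrassCurve
open Literature.NumberTheory.EllipticCurves Literature.NumberTheory.GaloisRepresentations
  Literature.NumberTheory.EllipticCurves.Rank1Residual
  Literature.NumberTheory.EllipticCurves.GreenbergVatsal2000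
open Summit.BirchSwinnertonDyer.BirchSwinnertonDyer.Theses.AdditiveBranchIMC

/-! ## §1 `U ∩ H¹(ℚ_Σ/ℚ_∞, Ψ)` sits inside `H¹(ℚ_Σ/ℚ_∞, Ψ)` -/

section Model

variable (W : WeierstrassCurve ℚ) (p : ℕ) [Fact p.Prime] (κ : ZpExtension ℚ p)
  (S₀ : Finset (HeightOneSpectrum (𝓞 ℚ)))
  (Φ₀ : AddSubgroup (geomTorsion W (p : ℤ))) (hΦ : IsRationalLine W p Φ₀)

/-- **`U ∩ H¹(ℚ_Σ/ℚ_∞, Ψ) ≤ H¹(ℚ_Σ/ℚ_∞, Ψ)`** in the tree's model: `residualQuotSelmer` is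
`unramifiedSelmer = unramifiedOutside ⊓ (unramified above p)`, a subgroup of
`unramifiedOutside κ.kerSubgroup Ψ p S₀ = H¹(ℚ_Σ/ℚ_∞, Ψ)` (GV p. 28: "`U = ker(H¹(ℚ_Σ/ℚ_∞, Ψ) →
H¹(I_p, Ψ))`"). [cite: GreenbergVatsal2000, §2 pp. 28–29] -/
theorem residualQuotSelmer_le_unramifiedOutside :
    residualQuotSelmer W p κ S₀ Φ₀ hΦ ≤
      unramifiedOutside κ.kerSubgroup (residualLine Φ₀ hΦ).Quot p
        (↑S₀ : Set (HeightOneSpectrum (𝓞 ℚ))) :=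
  inf_le_left

/-! ## §2 One datum: the printed display gives the lifting on `U` -/

/-- **The item's lifting from the PRINTED display, one datum.** If `ε : H¹(ℚ_Σ/ℚ_∞, E[p]) →
H¹(ℚ_Σ/ℚ_∞, Ψ)` is onto (GV p. 28: "we have an exact sequence
`0 → H¹(ℚ_Σ/ℚ_∞, Φ) → H¹(ℚ_Σ/ℚ_∞, E[p]) →ε H¹(ℚ_Σ/ℚ_∞, Ψ) → 0`", from p. 30's
`H²(ℚ_Σ/ℚ_∞, Φ) = 0`), read in the tree's model as "every class unramified outside `S₀ ∪ {p}` is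
`ε x` for an `x` unramified outside `S₀ ∪ {p}`", then every class of `U ∩ H¹(ℚ_Σ/ℚ_∞, Ψ)` lifts —
the conclusion of `residualEpsilon_surjOn_of_line[Ramified]Even` at this datum.
[cite: GreenbergVatsal2000, §2 p. 28 with p. 30] -/
theorem lift_of_display
    (hdisplay : ∀ s ∈ unramifiedOutside κ.kerSubgroup (residualLine Φ₀ hΦ).Quot p
        (↑S₀ : Set (HeightOneSpectrum (𝓞 ℚ))),
      ∃ x ∈ residualTorsionH1 W p κ S₀, residualEpsilon W p κ Φ₀ hΦ x = s) :
    ∀ s ∈ residualQuotSelmer W p κ S₀ Φ₀ hΦ, ∃ x ∈ residualTorsionH1 W p κ S₀,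
      residualEpsilon W p κ Φ₀ hΦ x = s :=
  fun s hs ↦ hdisplay s (residualQuotSelmer_le_unramifiedOutside W p κ S₀ Φ₀ hΦ hs)

end Model

/-! ## §3 The route declarations from the display -/

/-- **RF-4 (item 19299) from the printed display.** If, for every globally minimal elliptic `W/ℚ`,
odd `p`, cyclotomic `κ`, EVEN rational line `Φ₀ ≤ W[p]` and admissible `S₀` (`∌ p`, containing the
bad places `≠ p`), the map `ε` is onto `H¹(ℚ_Σ/ℚ_∞, Ψ)` (GV p. 28 display, p. 30 "because `φ` is
even"), then `GreenbergVatsalLiftingEven`. The hypothesis is the display VERBATIM in the tree's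
vocabulary; the theorem is the whole reading step. CONDITIONAL; nothing discharged.
[cite: GreenbergVatsal2000, §2 p. 28 with p. 30] -/
theorem greenbergVatsalLiftingEven_of_display
    (hdisplay : ∀ (W : WeierstrassCurve ℚ) [W.IsGloballyMinimal] [W.IsElliptic] (p : ℕ)
      [Fact p.Prime] (κ : ZpExtension ℚ p) (S₀ : Finset (HeightOneSpectrum (𝓞 ℚ)))
      (Φ₀ : AddSubgroup (W.geomTorsion (p : ℤ))) (hΦ : IsRationalLine W p Φ₀),
      p ≠ 2 → κ.IsCyclotomic → LineEven W p Φ₀ →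
      (∀ v ∈ S₀, ((p : ℕ) : 𝓞 ℚ) ∉ v.asIdeal) →
      (∀ v : HeightOneSpectrum (𝓞 ℚ), v ∉ S₀ → ((p : ℕ) : 𝓞 ℚ) ∉ v.asIdeal →
        W.HasGoodReductionAt v) →
      ∀ s ∈ unramifiedOutside κ.kerSubgroup (residualLine Φ₀ hΦ).Quot p
          (↑S₀ : Set (HeightOneSpectrum (𝓞 ℚ))),
        ∃ x ∈ residualTorsionH1 W p κ S₀, residualEpsilon W p κ Φ₀ hΦ x = s) :
    GreenbergVatsalLiftingEven :=
  fun W _ _ p _ κ S₀ Φ₀ hΦ hp hκ heven hS₀ hS ↦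
    lift_of_display W p κ S₀ Φ₀ hΦ (hdisplay W p κ S₀ Φ₀ hΦ hp hκ heven hS₀ hS)

/-- **RF-3 (item 19298) from the printed display** (same display, the extra hypothesis
`¬ LineUnramifiedAt W p Φ₀` of the ramified-even record idle). CONDITIONAL; nothing discharged.
[cite: GreenbergVatsal2000, §2 p. 28 with p. 30] -/
theorem greenbergVatsalLiftingRamifiedEven_of_display
    (hdisplay : ∀ (W : WeierstrassCurve ℚ) [W.IsGloballyMinimal] [W.IsElliptic] (p : ℕ)
      [Fact p.Prime] (κ : ZpExtension ℚ p) (S₀ : Finset (HeightOneSpectrum (𝓞 ℚ)))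
      (Φ₀ : AddSubgroup (W.geomTorsion (p : ℤ))) (hΦ : IsRationalLine W p Φ₀),
      p ≠ 2 → κ.IsCyclotomic → LineEven W p Φ₀ →
      (∀ v ∈ S₀, ((p : ℕ) : 𝓞 ℚ) ∉ v.asIdeal) →
      (∀ v : HeightOneSpectrum (𝓞 ℚ), v ∉ S₀ → ((p : ℕ) : 𝓞 ℚ) ∉ v.asIdeal →
        W.HasGoodReductionAt v) →
      ∀ s ∈ unramifiedOutside κ.kerSubgroup (residualLine Φ₀ hΦ).Quot p
          (↑S₀ : Set (HeightOneSpectrum (𝓞 ℚ))),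
        ∃ x ∈ residualTorsionH1 W p κ S₀, residualEpsilon W p κ Φ₀ hΦ x = s) :
    GreenbergVatsalLiftingRamifiedEven :=
  residualEpsilon_surjOn_of_lineRamifiedEven_of_lineEven (greenbergVatsalLiftingEven_of_display hdisplay)

/-- **The crux `ReadingFacts` (item 19361) from RF-1, RF-2, RF-5 and the printed display** (both
lifting conjuncts RF-3/RF-4 come from the display). CONDITIONAL on the three named readings and the
display; nothing discharged. [cite: GreenbergVatsal2000, §2 p. 28 with p. 30] -/
theorem readingFacts_of_display (h₁ : WuthrichHalfEigenDivisibility)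
    (h₂ : GreenbergVatsalResidualBranch) (h₅ : DelbourgoPotGoodOrdUnit)
    (hdisplay : ∀ (W : WeierstrassCurve ℚ) [W.IsGloballyMinimal] [W.IsElliptic] (p : ℕ)
      [Fact p.Prime] (κ : ZpExtension ℚ p) (S₀ : Finset (HeightOneSpectrum (𝓞 ℚ)))
      (Φ₀ : AddSubgroup (W.geomTorsion (p : ℤ))) (hΦ : IsRationalLine W p Φ₀),
      p ≠ 2 → κ.IsCyclotomic → LineEven W p Φ₀ →
      (∀ v ∈ S₀, ((p : ℕ) : 𝓞 ℚ) ∉ v.asIdeal) →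
      (∀ v : HeightOneSpectrum (𝓞 ℚ), v ∉ S₀ → ((p : ℕ) : 𝓞 ℚ) ∉ v.asIdeal →
        W.HasGoodReductionAt v) →
      ∀ s ∈ unramifiedOutside κ.kerSubgroup (residualLine Φ₀ hΦ).Quot p
          (↑S₀ : Set (HeightOneSpectrum (𝓞 ℚ))),
        ∃ x ∈ residualTorsionH1 W p κ S₀, residualEpsilon W p κ Φ₀ hΦ x = s) :
    ReadingFacts :=
  ⟨h₁, h₂, greenbergVatsalLiftingRamifiedEven_of_display hdisplay,
    greenbergVatsalLiftingEven_of_display hdisplay, h₅⟩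

end Summit.BirchSwinnertonDyer.BirchSwinnertonDyer.Theorems.AdditiveBranchIMCGreenbergVatsalLiftingEven

end
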